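import Summits.ValiantsHypothesis.ValiantsHypothesis.Theorems.BarrierLeverPartitionMinorsHitByVPExactCoverNoGoPrelims

/-!
# Route BarrierLever — item `PartitionMinorsHitByVP` (stmt-ValiantsHypothesis-19717):
# exact-cover certificates, part 2/3 — Reed–Solomon curve systems

Helper file (`--supports stmt-ValiantsHypothesis-19717`; cell valiant-natproofs, rung V4, 𝒟-side door (c);
prover seat val-np-p1 gen 14). Closes NO item.

The combinatorial input of the exact-cover no-go (part 3, `…ExactCoverNoGo`): over a finite field `F` with `q`
elements, the graphs `S_c = {(t, P_c(t)) : t ∈ F} ⊆ F × F` of the `q^d` polynomials `P_c = Σ_{j<d} c_j X^j` are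
`q`-sets that pairwise meet in `< d` points (`card_curve`, `card_curve_inter_lt`: two distinct polynomials of degree
`< d` agree at `< d` points). The row complex of the no-go is the union `R₀` of the cubes `2^{S_c}`
(`rsFamily`; a lower set, `isLowerSet_rsFamily`; `|R₀| ≤ q^d · 2^q`, `card_rsFamily_le`).

WHAT THIS IS NOT: no statement about item 19717; nothing on crux stmt-ValiantsHypothesis-14610 or `VP` versus `VNP`.
-/

set_option linter.dupNamespace false

namespace Summit.ValiantsHypothesis.ValiantsHypothesis.Theorems.BarrierLever.ExactCoverNoGo

open Finset

noncomputable section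

variable {F : Type*} [Field F] {h d : ℕ}

/-- The polynomial `P_c = Σ_{j<d} c_j X^j` with coefficient vector `c`. -/
def rsPoly (c : Fin d → F) : Polynomial F := ∑ j : Fin d, Polynomial.C (c j) * Polynomial.X ^ (j : ℕ)

/-- Coefficients of `P_c`. -/
theorem coeff_rsPoly (c : Fin d → F) (n : ℕ) :
    (rsPoly c).coeff n = if hn : n < d then c ⟨n, hn⟩ else 0 := by
  rw [rsPoly, Polynomial.finsetSum_coeff]
  simp only [Polynomial.coeff_C_mul_X_pow]
  by_cases hn : n < d
  · rw [dif_pos hn, Finset.sum_eq_single ⟨n, hn⟩]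
    · rw [if_pos rfl]
    · intro j _ hj; rw [if_neg (fun hnj => hj (Fin.ext hnj.symm))]
    · intro habs; exact absurd (Finset.mem_univ _) habs
  · rw [dif_neg hn]
    exact Finset.sum_eq_zero (fun j _ => if_neg (fun hnj => hn (by rw [hnj]; exact j.isLt)))

/-- `c ↦ P_c` is injective. -/
theorem rsPoly_injective : Function.Injective (rsPoly (F := F) (d := d)) := by
  intro c c' hcc'
  funext j
  have := congrArg (fun P => Polynomial.coeff P (j : ℕ)) hcc'
  simp only [coeff_rsPoly, dif_pos j.isLt, Fin.eta] at this
  exact this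

/-- `deg P_c < d` (for `d ≥ 1`). -/
theorem natDegree_rsPoly_le (c : Fin d → F) : (rsPoly c).natDegree ≤ d - 1 := by
  rw [rsPoly]
  refine Polynomial.natDegree_sum_le_of_forall_le _ _ (fun j _ => ?_)
  exact (Polynomial.natDegree_C_mul_X_pow_le _ _).trans (by have := j.isLt; omega)

variable [Fintype F] (e : F × F ≃ Fin h)

/-- The graph `S_c = {(t, P_c(t))}` of `P_c`, transported to `Fin h` along `e : F × F ≃ Fin h`. -/
def curve (c : Fin d → F) : Finset (Fin h) := Finset.univ.image (fun t : F => e (t, (rsPoly c).eval t))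

/-- `|S_c| = q`. -/
theorem card_curve (c : Fin d → F) : (curve e c).card = Fintype.card F := by
  rw [curve, Finset.card_image_of_injective _ (fun t t' htt' => (Prod.ext_iff.mp (e.injective htt')).1),
    Finset.card_univ]

/-- **Reed–Solomon intersection bound**: two distinct graphs meet in `< d` points (`d ≥ 1`). -/
theorem card_curve_inter_lt (hd : 1 ≤ d) (c c' : Fin d → F) (hcc' : c ≠ c') :
    (curve e c ∩ curve e c').card < d := by
  classical
  have hP : rsPoly c - rsPoly c' ≠ 0 := fun h0 => hcc' (rsPoly_injective (sub_eq_zero.mp h0))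
  have hsub : curve e c ∩ curve e c' ⊆
      (rsPoly c - rsPoly c').roots.toFinset.image (fun t : F => e (t, (rsPoly c).eval t)) := by
    intro x hx
    rw [Finset.mem_inter, curve, curve, Finset.mem_image, Finset.mem_image] at hx
    obtain ⟨⟨t, _, hx1⟩, ⟨t', _, hx2⟩⟩ := hx
    have htt : (t', (rsPoly c').eval t') = (t, (rsPoly c).eval t) := e.injective (hx2.trans hx1.symm)
    rw [Prod.mk.injEq] at htt
    obtain ⟨htt1, hev⟩ := htt
    rw [htt1] at hev
    refine Finset.mem_image.mpr ⟨t, ?_, hx1⟩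
    rw [Multiset.mem_toFinset, Polynomial.mem_roots hP, Polynomial.IsRoot, Polynomial.eval_sub, ← hev, sub_self]
  calc (curve e c ∩ curve e c').card
      ≤ ((rsPoly c - rsPoly c').roots.toFinset.image (fun t : F => e (t, (rsPoly c).eval t))).card :=
        Finset.card_le_card hsub
    _ ≤ (rsPoly c - rsPoly c').roots.toFinset.card := Finset.card_image_le
    _ ≤ Multiset.card (rsPoly c - rsPoly c').roots := Multiset.toFinset_card_le _
    _ ≤ (rsPoly c - rsPoly c').natDegree := Polynomial.card_roots' _
    _ ≤ max (rsPoly c).natDegree (rsPoly c').natDegree := Polynomial.natDegree_sub_le _ _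
    _ ≤ d - 1 := max_le (natDegree_rsPoly_le c) (natDegree_rsPoly_le c')
    _ < d := by omega

/-- **The row complex of the no-go**: the union of the cubes `2^{S_c}` over all `q^d` graphs. -/
def rsFamily (d : ℕ) : Finset (Finset (Fin h)) :=
  (Finset.univ : Finset (Fin d → F)).biUnion (fun c => (curve e c).powerset)

/-- Membership: `S ∈ R₀` iff `S` lies on some graph. -/
theorem mem_rsFamily (S : Finset (Fin h)) : S ∈ rsFamily e d ↔ ∃ c : Fin d → F, S ⊆ curve e c := by
  simp [rsFamily]

/-- The graphs themselves are rows. -/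
theorem curve_mem_rsFamily (c : Fin d → F) : curve e c ∈ rsFamily e d :=
  (mem_rsFamily e _).mpr ⟨c, Finset.Subset.refl _⟩

/-- `R₀` is a lower set (an abstract simplicial complex). -/
theorem isLowerSet_rsFamily : IsLowerSet (↑(rsFamily e d) : Set (Finset (Fin h))) := by
  intro S S' hS'S hS
  obtain ⟨c, hc⟩ := (mem_rsFamily e S).mp hS
  exact (mem_rsFamily e S').mpr ⟨c, fun x hx => hc (hS'S hx)⟩

/-- `|R₀| ≤ q^d · 2^q`. -/
theorem card_rsFamily_le : (rsFamily e d).card ≤ Fintype.card F ^ d * 2 ^ Fintype.card F := by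
  calc (rsFamily e d).card ≤ ∑ c : Fin d → F, ((curve e c).powerset).card := Finset.card_biUnion_le
    _ = ∑ _c : Fin d → F, 2 ^ Fintype.card F := by
        refine Finset.sum_congr rfl (fun c _ => ?_); rw [Finset.card_powerset, card_curve]
    _ = Fintype.card F ^ d * 2 ^ Fintype.card F := by
        rw [Finset.sum_const, smul_eq_mul, Finset.card_univ, Fintype.card_fun, Fintype.card_fin]

/-- `|R₀| ≥ 1`. -/
theorem one_le_card_rsFamily (hd : ∃ _c : Fin d → F, True) : 1 ≤ (rsFamily e d).card := by
  obtain ⟨c, -⟩ := hd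
  exact Finset.card_pos.mpr ⟨_, curve_mem_rsFamily e c⟩

end

end Summit.ValiantsHypothesis.ValiantsHypothesis.Theorems.BarrierLever.ExactCoverNoGo
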